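import Literature.Probability.Percolation.KozmaNitzanClusterProperty
import HarnessLib

/-!
# Kozma–Nitzan's Question 9 for observers with STRONG PORTS (a generalisation of their Theorem 4)

Support file (`--supports stmt-CriticalPhenomena-4575`), prover `prim-ineq-gen-6` (gen 11; memo `prim-ineq-gen-6/FINDING-G11.md` §2).
No definitions, no named facts, no sorries; standard axioms.

Kozma–Nitzan (arXiv:2401.12397), Question 9 (p. 36): "Let `H` be the graph given from `G` by removing all edges going out of `0`.
Let `a` be the point minimising `P_H(a ↔ b)` among the points of `A`. Is it true that in this case `(41)`
[`P(0 ↔ b, 0 ↔ A) ≥ P(0 ↔ A, a ↔ b)`] holds?"  Their Theorem 4 (p. 12, proof pp. 13–14) answers YES when `0` is isolated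
in `G ∖ A`, i.e. when every port of `0` (vertex joined to `0` by a pair of positive weight) is a relay: star by star
(`σ_B` = "the open pairs at `0` are exactly those to `B`"), Lemma 5 (p. 13) compares the designated relay with a port
`v ∈ B`.

THIS FILE: the same star-by-star argument goes through for an ARBITRARY observer `0 ∉ A` provided every NON-relay port
`p` of `0` is STRONG:  `P_H(p ↔ b, p ↔ A) ≥ P_H(c ↔ b)`  (relay ports only need `P_H(p ↔ b) ≥ P_H(c ↔ b)`, automatic for
the `H`-minimiser `c`).  The tool is the tree's cluster-property Lemma 5 (`KozmaNitzan2024_lemma5_cluster`, the step behind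
Kozma–Nitzan's Theorem 8) applied to the monotone vertex-set predicate `P(S) = (b ∈ S ∧ S ∩ A ≠ ∅)`: for the relay `c` it
reads `{c ↔ b}`, for the observer it reads `{0 ↔ b, 0 ↔ A}`.

* `KNQ9.preFKG_designated_of_strongPorts` — `0 ∉ A`, `c ∈ A`; every relay port `p` has `P_H(c↔b) ≤ P_H(p↔b)` and every
  non-relay port `p` has `P_H(c↔b) ≤ P_H(p↔b, p↔A)`; then `P(c ↔ b, 0 ↔ A) ≤ P(0 ↔ b, 0 ↔ A)`.
* `KNQ9.question9_of_strongPorts` — the printed designation (`c` = a minimiser of `P_H(· ↔ b)` over `A`) under the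
  strong-port hypothesis on the non-relay ports.  Kozma–Nitzan's Theorem 4 (`KozmaNitzan2024_thm4_witness`) is the case
  without non-relay ports.  (Exact census of the cell memo, n ≤ 6 exhaustive graphs: Theorem 4's hypothesis covers 23 % of
  the Question-9 instances, the strong-port hypothesis 72 %; Question 9 itself had 0 violations in 12.25·10⁶ designations
  through n = 7, kit job j089473.)
[cite: KozmaNitzan2024, Question 9 (p. 36), Thm. 4 (p. 12) and its proof (pp. 13–14), Lemma 5 (p. 13), Thm. 8 (p. 32)]
-/

noncomputable section

namespace Summit.CriticalPhenomena.PercolationContinuityZ3.Theorems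

open MeasureTheory Set Literature.Probability.LatticeModels Literature.Probability.Percolation
open scoped Classical

namespace KNQ9

variable {V : Type*} [Fintype V]

open KNPreFKG in
/-- **Kozma–Nitzan's pre-FKG inequality (41) for a designated relay dominated by every port, STRONG-PORT form.**
`0 ∉ A`, `c ∈ A`; for every relay port `p ∈ A` of `0` (`w s(0,p) ≠ 0`): `P_{G∖0}(c ↔ b) ≤ P_{G∖0}(p ↔ b)`; for every
non-relay port `p ∉ A`, `p ≠ 0`: `P_{G∖0}(c ↔ b) ≤ P_{G∖0}(p ↔ b, p ↔ A)`.  Then `P(c ↔ b, 0 ↔ A) ≤ P(0 ↔ b, 0 ↔ A)`.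
Proof: decompose both sides along the stars `σ_B`, `B ⊆ V ∖ {0}` (`real_eq_sum_inter_starEvent` with the vacuous
isolation hypothesis); a nonempty star of positive probability contains a port `v`, and the cluster-property Lemma 5
(`KozmaNitzan2024_lemma5_cluster`) for the monotone predicate `S ↦ b ∈ S ∧ (∃ a ∈ A, a ∈ S)` with that `v` gives
`P(c ↔ b, σ_B) ≤ P(0 ↔ b, 0 ↔ A, σ_B)`; the empty star forces `0 ↮ A`.
[cite: KozmaNitzan2024, Question 9 (p. 36), Lemma 5 (p. 13), proof of Thm. 4 (pp. 13–14), Thm. 8 (p. 32)] -/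
theorem preFKG_designated_of_strongPorts (w : Sym2 V → unitInterval) (A : Finset V) (o b c : V)
    (hoA : o ∉ A) (hcA : c ∈ A)
    (hrel : ∀ p ∈ A, w s(o, p) ≠ 0 →
      (prodBernoulli w).real (openConnIn ({o}ᶜ : Set V) c b) ≤
        (prodBernoulli w).real (openConnIn ({o}ᶜ : Set V) p b))
    (hnon : ∀ p, p ∉ A → p ≠ o → w s(o, p) ≠ 0 →
      (prodBernoulli w).real (openConnIn ({o}ᶜ : Set V) c b) ≤
        (prodBernoulli w).real (openConnIn ({o}ᶜ : Set V) p b ∩ ⋃ a ∈ A, openConnIn ({o}ᶜ : Set V) p a)) :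
    (prodBernoulli w).real (openConn c b ∩ ⋃ a' ∈ A, openConn o a') ≤
      (prodBernoulli w).real (openConn o b ∩ ⋃ a' ∈ A, openConn o a') := by
  classical
  set μ := prodBernoulli w with hμ
  have hco : c ≠ o := fun h => hoA (h ▸ hcA)
  -- the monotone predicate `b ∈ S ∧ S meets A`
  set P : Set V → Prop := fun S => b ∈ S ∧ ∃ a ∈ A, a ∈ S with hPdef
  have hP : ∀ S T : Set V, S ⊆ T → P S → P T := by
    rintro S T hST ⟨hb, a, ha, haS⟩
    exact ⟨hST hb, a, ha, hST haS⟩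
  -- reading the predicate on the clusters of `c` and of `o`
  have hPc : {ω : BondConfig V | P (openCluster ω c)} = openConn c b := by
    ext ω
    simp only [mem_setOf_eq, hPdef]
    constructor
    · rintro ⟨hb, -⟩; exact hb
    · intro hb; exact ⟨hb, c, hcA, mem_openCluster_self ω c⟩
  have hPo : {ω : BondConfig V | P (openCluster ω o)} = openConn o b ∩ ⋃ a' ∈ A, openConn o a' := by
    ext ω
    simp only [mem_setOf_eq, hPdef, mem_inter_iff, mem_iUnion, exists_prop]
    rfl
  have hPc' : {ω : BondConfig V | P {y | ω ∈ openConnIn ({o}ᶜ : Set V) c y}} = openConnIn ({o}ᶜ : Set V) c b := by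
    ext ω
    simp only [mem_setOf_eq, hPdef]
    constructor
    · rintro ⟨hb, -⟩; exact hb
    · intro hb
      refine ⟨hb, c, hcA, ?_⟩
      show ω ∈ openConnIn ({o}ᶜ : Set V) c c
      exact ⟨hco, hco, SimpleGraph.Reachable.refl _⟩
  have hPp' : ∀ p : V, {ω : BondConfig V | P {y | ω ∈ openConnIn ({o}ᶜ : Set V) p y}} =
      openConnIn ({o}ᶜ : Set V) p b ∩ ⋃ a ∈ A, openConnIn ({o}ᶜ : Set V) p a := by
    intro p; ext ω
    simp only [mem_setOf_eq, hPdef, mem_inter_iff, mem_iUnion, exists_prop]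
  -- the stars of `o` over ALL other vertices partition the space (no isolation hypothesis needed)
  set N : Finset V := Finset.univ.erase o with hN
  have hoN : o ∉ N := Finset.notMem_erase o _
  have hisoN : ∀ u, u ≠ o → u ∉ N → w s(o, u) = 0 := fun u huo huN =>
    absurd (Finset.mem_erase.2 ⟨huo, Finset.mem_univ u⟩) huN
  rw [real_eq_sum_inter_starEvent w N o hoN hisoN (openConn c b ∩ _),
    real_eq_sum_inter_starEvent w N o hoN hisoN (openConn o b ∩ _)]
  refine Finset.sum_le_sum fun B hB => ?_
  rcases B.eq_empty_or_nonempty with rfl | hBne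
  · -- under `σ_∅` the observer is isolated, so `0 ↮ A`
    have h0 : (openConn c b ∩ ⋃ a' ∈ A, openConn o a') ∩ starEvent o ↑(∅ : Finset V) =
        (∅ : Set (BondConfig V)) := by
      ext ω
      simp only [mem_inter_iff, mem_iUnion, exists_prop, mem_empty_iff_false, iff_false, not_and]
      rintro ⟨-, a', ha', hoa'⟩ hσ
      rw [Finset.coe_empty] at hσ
      exact not_reachable_of_mem_starEvent_empty hσ (fun h => hoA (h ▸ ha')) hoa'
    rw [h0, measureReal_empty]
    exact measureReal_nonneg
  · by_cases hport : ∃ v ∈ B, w s(o, v) ≠ 0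
    · -- `B` contains a port `v`: the cluster-property Lemma 5 with that `v`
      obtain ⟨v, hv, hwv⟩ := hport
      have hvo : v ≠ o := (Finset.mem_erase.1 (Finset.mem_powerset.1 hB hv)).1
      have hyp : μ.real {ω : BondConfig V | P {y | ω ∈ openConnIn ({o}ᶜ : Set V) c y}} ≤
          μ.real {ω : BondConfig V | P {y | ω ∈ openConnIn ({o}ᶜ : Set V) v y}} := by
        rw [hPc', hPp' v]
        by_cases hvA : v ∈ A
        · refine (hrel v hvA hwv).trans (measureReal_mono fun ω hω => ⟨hω, ?_⟩)
          exact mem_iUnion₂.2 ⟨v, hvA, ⟨hvo, hvo, SimpleGraph.Reachable.refl _⟩⟩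
        · exact hnon v hvA hvo hwv
      have L5 := KozmaNitzan2024_lemma5_cluster w o c v (↑B) P hP hco hvo (Finset.mem_coe.2 hv) hyp
      rw [hPc, hPo] at L5
      calc μ.real ((openConn c b ∩ ⋃ a' ∈ A, openConn o a') ∩ starEvent o ↑B)
          ≤ μ.real (openConn c b ∩ starEvent o ↑B) :=
            measureReal_mono fun ω ⟨⟨h1, _⟩, h2⟩ => ⟨h1, h2⟩
        _ ≤ μ.real ((openConn o b ∩ ⋃ a' ∈ A, openConn o a') ∩ starEvent o ↑B) := L5
    · -- `B ≠ ∅` without ports: the star asks a weight-`0` pair to be open, a null event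
      push Not at hport
      obtain ⟨v, hv⟩ := hBne
      have hvo : v ≠ o := (Finset.mem_erase.1 (Finset.mem_powerset.1 hB hv)).1
      have hnull : μ.real (starEvent o (↑B : Set V)) = 0 := by
        refine le_antisymm ?_ measureReal_nonneg
        calc μ.real (starEvent o (↑B : Set V))
            ≤ μ.real {ω : BondConfig V | s(o, v) ∈ ω} := measureReal_mono fun ω hσ =>
                ((mem_starEvent_iff o (↑B) ω).1 hσ v hvo).2 (Finset.mem_coe.2 hv)
          _ = 0 := by
                rw [hμ, prodBernoulli_real_setOf_mem, hport v hv]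
                rfl
      have h0 : μ.real ((openConn c b ∩ ⋃ a' ∈ A, openConn o a') ∩ starEvent o ↑B) = 0 :=
        le_antisymm ((measureReal_mono inter_subset_right).trans hnull.le) measureReal_nonneg
      rw [h0]
      exact measureReal_nonneg

/-- **Question 9 of Kozma–Nitzan for observers with strong ports.**  `0 ∉ A`, `c ∈ A` ANY minimiser of
`P_{G∖0}(· ↔ b)` over `A` (the designation of Question 9; ties allowed), and every non-relay port `p` of `0` strong:
`P_{G∖0}(c ↔ b) ≤ P_{G∖0}(p ↔ b, p ↔ A)`.  Then `P(0 ↔ A, c ↔ b) ≤ P(0 ↔ b, 0 ↔ A)` — inequality (41).  With no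
non-relay ports this is Kozma–Nitzan's Theorem 4 (`KozmaNitzan2024_thm4`, `KozmaNitzan2024_thm4_witness`).
[cite: KozmaNitzan2024, Question 9 (p. 36), Thm. 4 (p. 12), Lemma 5 (p. 13)] -/
theorem question9_of_strongPorts (w : Sym2 V → unitInterval) (A : Finset V) (o b c : V)
    (hoA : o ∉ A) (hcA : c ∈ A)
    (hcmin : ∀ a ∈ A, (prodBernoulli w).real (openConnIn ({o}ᶜ : Set V) c b) ≤
      (prodBernoulli w).real (openConnIn ({o}ᶜ : Set V) a b))
    (hnon : ∀ p, p ∉ A → p ≠ o → w s(o, p) ≠ 0 →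
      (prodBernoulli w).real (openConnIn ({o}ᶜ : Set V) c b) ≤
        (prodBernoulli w).real (openConnIn ({o}ᶜ : Set V) p b ∩ ⋃ a ∈ A, openConnIn ({o}ᶜ : Set V) p a)) :
    (prodBernoulli w).real (openConn c b ∩ ⋃ a' ∈ A, openConn o a') ≤
      (prodBernoulli w).real (openConn o b ∩ ⋃ a' ∈ A, openConn o a') :=
  preFKG_designated_of_strongPorts w A o b c hoA hcA (fun p hp _ => hcmin p hp) hnon

end KNQ9

end Summit.CriticalPhenomena.PercolationContinuityZ3.Theorems

end
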